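import Summits.AtomisticToContinuum.HydrodynamicLimit.Theorems.ImplosionDichotomyDenseExcursionKidderKnob
import Literature.Analysis.FunctionSpaces.TorusMollifier

/-!
# The kinematic Kidder knob family on `𝕋³` (line `kidder-knob-melnikov`, stub `stub_kidderKnob`)

Crux `Summit.AtomisticToContinuum.HydrodynamicLimit.Theses.ImplosionDichotomy.DenseExcursion`
(stmt-AtomisticToContinuum-12586), line `Cruxes/DenseExcursion/Lines/kidder-knob-melnikov.lean`, registered
stub `stub_kidderKnob : KidderKnob` (lead's kinematic reshape 2/3); `KnobFamily` and `KidderKnob` are copied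
verbatim from the skeleton. **Construction.** Profiles `(r, Pf₀, Uf, Qf)` from the landed
`exists_knobProfile` (BCG 2025 Thm 1.1 at `γ = 5/3`, the hypothesis, by name). The far field bounds the closed
subsonic set `{ζ ≥ 0 : (ζ/r + Uf)² ≤ (5/3) Qf}` by some `Z` (`exists_subsonic_bound`); with the core chart
radius `Rc = 1/128`, the blow-up time `T = (Rc/(2Z))^r` puts the backward acoustic cone inside the core.
Centre `x₀ = 0`, knob range `bLo = -(15/16)/T`. With one bump `χ` (`= 1` on `‖y‖ ≤ 1/8`, supported in
`‖y‖ < 1/4`) the data are transplants (`Torus.transplant`, exact on the chart ball `‖y‖ < 1/2`) of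
`1 + χ(profile − 1)` (activity, temperature: smooth, positive) and of `χ(self-similar velocity − b y)`; the
reference fields are, for `t ≠ 0`, transplants of `χ·`(Kidder image of the self-similar chart ansatz) and, at
`t = 0`, the data. The density profile is rescaled, `Pf = T^{3(1−1/r)} Pf₀ / ∫a₀` (an exact symmetry of
every profile clause), so that `a₀/∫a₀` IS the `t = 0` ansatz on the core. All cores
`‖y‖ < Rc(1 − bt) < 16 Rc = 1/8` lie in the plateau of `χ`, where the Kidder relation holds by unfolding.
Torus-chart calculus only; no PDE theory.
-/
noncomputable section

open MeasureTheory Set Filter Topology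
open scoped ContDiff

namespace Summit.AtomisticToContinuum.HydrodynamicLimit.Theorems.KidderKnobMelnikov

open Literature.MathematicalPhysics.KineticTheory (T3 V3 IsHardSphereEulerSolution hsDiameter localGibbsLaw
  TendstoHydroFieldsAt)
open Literature.Analysis.FunctionSpaces (Torus.proj Torus.IsSmooth Torus.lift Torus.transplant Torus.reprc
  Torus.transplant_apply Torus.transplant_proj_of_norm_lt Torus.isSmooth_transplant Torus.isSmooth_const)

/-! ## The interface and the statement (verbatim: skeleton `kidder-knob-melnikov.lean`, Stub 2) -/

/-- **Knob family** (interface; the construction is `stub_kidderKnob`; KINEMATIC since the lead's reshape 2,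
see the module docstring). A seed of the unit torus by the spherically symmetric, isentropic, exactly
self-similar implosion of the monatomic ideal gas with blow-up speed `r` in the window `(1.1, 1.135)` — it
contains BCG's certified bracket `(1.10102, 1.13476)` of Theorem 1.1 at `γ = 5/3` (the `ν = 3, 4` Frobenius
poles; vendored as `Literature.Analysis.FluidPDE.BuckmasterCaolaboraGomezserrano2025_thm11_monatomic`) and,
numerically, exactly one smooth profile, `r₂ = 1.1128162` (RaceResults.md) — recorded by its PROFILE
(`Pf, Uf, Qf` smooth as radial fields on `ℝ³`, positive, isentropic, solving the three reduced self-similar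
equations of the full ideal monatomic system, far field `P_∞`), centred at `x₀`, blowing up at time `T`, with
reference fields `ρI 0, uI 0, θI 0` EQUAL to the exact self-similar ansatz on the core chart ball `‖y‖ < Rc`
for all `t < T`, together with its KNOB: for every `b` with `bT > bLo·T ≥ -1` (range at least
`bT > −15/16`) the velocity datum is sheared by `−b·y` inside the core (activity and temperature data
UNCHANGED) and the reference fields of member `b` are, on the core `‖y‖ < Rc(1 − bt)`, `t < T/(1+bT)`, the
exact projective (Kidder) image of member `0`. No field asserts that the reference fields solve a PDE on the
torus: on the core they solve the ideal system by the profile equations + `ProjectiveCovariance` (a lemma for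
whoever needs it — the tracking stub), and off the core they are not read by anything. Local coordinates:
`y : V3 ↦ x₀ + Torus.proj y`. -/
structure KnobFamily where
  /-- centre of the seed -/
  x₀ : T3
  /-- core chart radius (`16 Rc < 1/2`: the cores `‖y‖ < Rc (1 - b t)` of all members, `1 - b t < 16`, stay in the chart) -/
  Rc : ℝ
  /-- blow-up time of the unsheared member -/
  T : ℝ
  /-- self-similar blow-up speed (`SS(r₂)` bracket) -/
  r : ℝ
  /-- lower end of the knob (`-1 < bLo·T ≤ -15/16`) -/
  bLo : ℝ
  /-- activity datum (knob-independent) -/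
  a₀ : T3 → ℝ
  /-- temperature datum (knob-independent) -/
  θ₀ : T3 → ℝ
  /-- velocity datum of member `b` -/
  u₀ : ℝ → T3 → V3
  /-- self-similar density / radial-velocity / temperature profiles of the unsheared member -/
  Pf : ℝ → ℝ
  Uf : ℝ → ℝ
  Qf : ℝ → ℝ
  /-- ideal (`σ = 0`) development of member `b`: density, temperature, velocity -/
  ρI : ℝ → ℝ → T3 → ℝ
  θI : ℝ → ℝ → T3 → ℝ
  uI : ℝ → ℝ → T3 → V3
  hRc : 0 < Rc ∧ Rc < 1 / 32
  hT : 0 < T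
  hr : 11 / 10 < r ∧ r < 227 / 200
  hbLo : -1 < bLo * T ∧ bLo * T ≤ -(15 / 16)
  cont : Continuous a₀ ∧ Continuous θ₀ ∧ ∀ b, Continuous (u₀ b)
  pos : ∀ x, 0 < a₀ x ∧ 0 < θ₀ x
  smoothActivity : Torus.IsSmooth (fun x => a₀ x / ∫ y, a₀ y)
  /-- the knob acts on the velocity datum only, as the homologous shear `-b·y` on the core -/
  knobData : ∀ (b : ℝ) (y : V3), ‖y‖ < Rc → u₀ b (x₀ + Torus.proj y) = u₀ 0 (x₀ + Torus.proj y) - b • y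
  /-- the `t = 0` slices of the reference fields are the data of the member (globally on `𝕋³`) -/
  data : ∀ b, bLo < b → (∀ x, ρI b 0 x = a₀ x / ∫ y, a₀ y) ∧ uI b 0 = u₀ b ∧ θI b 0 = θ₀
  /-- the profiles are smooth as radial fields on `ℝ³` (density, velocity `Uf(|y|) y/|y|`, temperature) -/
  smoothProfile : ContDiff ℝ ∞ (fun y : V3 => Pf ‖y‖) ∧
    ContDiff ℝ ∞ (fun y : V3 => (Uf ‖y‖ / ‖y‖) • y) ∧ ContDiff ℝ ∞ (fun y : V3 => Qf ‖y‖)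
  profilePos : ∀ ζ, 0 ≤ ζ → 0 < Pf ζ ∧ 0 < Qf ζ
  /-- isentropic core (monatomic adiabat `θ = k ρ^{2/3}`) -/
  isentropic : ∃ k : ℝ, 0 < k ∧ ∀ ζ, 0 ≤ ζ → Qf ζ = k * Pf ζ ^ (2 / 3 : ℝ)
  /-- the three reduced self-similar equations (continuity, radial momentum with `p = ρθ`, temperature with
  `e = 3θ/2`) of the ansatz `ρ = (T−t)^{−3(1−1/r)} Pf(ζ)`, `u = (T−t)^{1/r−1} Uf(ζ) ŷ`,
  `θ = (T−t)^{2(1/r−1)} Qf(ζ)`, `ζ = R/(T−t)^{1/r}`, for `ζ > 0` (literally the conclusion of the landed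
  `Theorems.KidderKnobMelnikov.exists_knobProfile`) -/
  profileODE : ∀ ζ, 0 < ζ →
    3 * (1 - 1 / r) * Pf ζ + (ζ / r + Uf ζ) * deriv Pf ζ + Pf ζ * (deriv Uf ζ + 2 * Uf ζ / ζ) = 0 ∧
    (1 - 1 / r) * Uf ζ + (ζ / r + Uf ζ) * deriv Uf ζ + deriv Qf ζ + Qf ζ * deriv Pf ζ / Pf ζ = 0 ∧
    2 * (1 - 1 / r) * Qf ζ + (ζ / r + Uf ζ) * deriv Qf ζ +
      2 / 3 * Qf ζ * (deriv Uf ζ + 2 * Uf ζ / ζ) = 0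
  /-- far field `P_∞`: `Uf/ζ → 0`, `Qf/ζ² → 0` -/
  farField : Tendsto (fun ζ => Uf ζ / ζ) atTop (𝓝 0) ∧ Tendsto (fun ζ => Qf ζ / ζ ^ 2) atTop (𝓝 0)
  /-- the core at `t = 0` contains the closed backward acoustic cone of the singular point: every self-similar
  radius `ζ` at which the profile is subsonic or sonic relative to the similarity frame
  (`(ζ/r + U_f)² ≤ c² = (5/3) Q_f`, ideal monatomic sound speed) satisfies `ζ T^{1/r} < Rc` (lead's reshape 3:
  without it the reference member is self-similar on the core only kinematically, the true ideal development
  of the data is not, and nothing can track it) -/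
  coneInCore : ∀ ζ, 0 ≤ ζ → (ζ / r + Uf ζ) ^ 2 ≤ 5 / 3 * Qf ζ → ζ * T ^ (1 / r) < Rc
  /-- exact self-similarity of the unsheared member on the core chart, for all `t < T` -/
  selfSimilar : ∀ t, 0 ≤ t → t < T → ∀ y : V3, ‖y‖ < Rc →
      ρI 0 t (x₀ + Torus.proj y) = (T - t) ^ (-(3 * (1 - 1 / r))) * Pf (‖y‖ / (T - t) ^ (1 / r)) ∧
      uI 0 t (x₀ + Torus.proj y) =
        ((T - t) ^ (1 / r - 1) * Uf (‖y‖ / (T - t) ^ (1 / r)) / ‖y‖) • y ∧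
      θI 0 t (x₀ + Torus.proj y) = (T - t) ^ (2 * (1 / r - 1)) * Qf (‖y‖ / (T - t) ^ (1 / r))
  /-- the Kidder relation: on the shrinking core, member `b` is the projective image of member `0`
  (`λ = (1 - b t)⁻¹`; density weight `λ³`, velocity `λ(u - b y)`, temperature `λ²`, arguments `(λt, λy)`) -/
  kidder : ∀ b, bLo < b → ∀ t, 0 ≤ t → t < T / (1 + b * T) → ∀ y : V3, ‖y‖ < Rc * (1 - b * t) →
      ρI b t (x₀ + Torus.proj y) =
        (1 - b * t)⁻¹ ^ 3 * ρI 0 ((1 - b * t)⁻¹ * t) (x₀ + Torus.proj ((1 - b * t)⁻¹ • y)) ∧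
      uI b t (x₀ + Torus.proj y) =
        (1 - b * t)⁻¹ • (uI 0 ((1 - b * t)⁻¹ * t) (x₀ + Torus.proj ((1 - b * t)⁻¹ • y)) - b • y) ∧
      θI b t (x₀ + Torus.proj y) =
        (1 - b * t)⁻¹ ^ 2 * θI 0 ((1 - b * t)⁻¹ * t) (x₀ + Torus.proj ((1 - b * t)⁻¹ • y))

/-- Statement of `stub_kidderKnob`: given the Buckmaster–Cao-Labora–Gómez-Serrano profile theorem at
`γ = 5/3` (named fact), a knob family exists: profiles from `exists_knobProfile` (landed), `T`, `Rc`, `x₀`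
chosen with `16 Rc < 1/2` so every member's core stays inside the chart, data = smooth positive cut-off
extensions of the core profiles with `∫ a₀ = 1` arranged off the core, reference fields = the self-similar
ansatz and its Kidder images (torus-chart calculus only; no hyperbolic PDE theory). -/
def KidderKnob : Prop :=
  Literature.Analysis.FluidPDE.BuckmasterCaolaboraGomezserrano2025_thm11_monatomic → Nonempty KnobFamily

/-! ## Helpers: subsonic bound, Kidder window, cut-off, chart fields, transplanted data -/

/-- If `Uf/ζ → 0` and `Qf/ζ² → 0` at infinity then the closed subsonic set
`{ζ ≥ 0 : (ζ/r + Uf ζ)² ≤ (5/3) Qf ζ}` of the self-similar profile is bounded: for large `ζ` the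
relative speed `ζ(1/r + Uf/ζ) > ζ/(2r)` beats the sound speed, `(5/3) Qf < ζ²/(4r²)`. [folklore] -/
theorem exists_subsonic_bound {r : ℝ} (hr : 0 < r) {Uf Qf : ℝ → ℝ}
    (hU : Tendsto (fun ζ => Uf ζ / ζ) atTop (𝓝 0)) (hQ : Tendsto (fun ζ => Qf ζ / ζ ^ 2) atTop (𝓝 0)) :
    ∃ Z : ℝ, 0 < Z ∧ ∀ ζ, 0 ≤ ζ → (ζ / r + Uf ζ) ^ 2 ≤ 5 / 3 * Qf ζ → ζ < Z := by
  have h1 : ∀ᶠ ζ in atTop, dist (Uf ζ / ζ) 0 < 1 / (2 * r) := Metric.tendsto_nhds.1 hU _ (by positivity)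
  have h2 : ∀ᶠ ζ in atTop, dist (Qf ζ / ζ ^ 2) 0 < 3 / (20 * r ^ 2) :=
    Metric.tendsto_nhds.1 hQ _ (by positivity)
  obtain ⟨Z, hZ⟩ := Filter.eventually_atTop.1 (h1.and (h2.and (eventually_ge_atTop 1)))
  refine ⟨max Z 1, lt_max_of_lt_right one_pos, fun ζ hζ hc => ?_⟩
  by_contra hlt
  obtain ⟨hu, hq, hζ1⟩ := hZ ζ ((le_max_left Z 1).trans (not_lt.1 hlt))
  rw [Real.dist_0_eq_abs, abs_lt] at hu hq
  have hζ0 : 0 < ζ := by linarith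
  have hlow : 1 / (2 * r) < 1 / r + Uf ζ / ζ := by
    have : 1 / r = 2 * (1 / (2 * r)) := by field_simp
    linarith [hu.1]
  have hL : ζ ^ 2 * (1 / (2 * r)) ^ 2 < (ζ / r + Uf ζ) ^ 2 := by
    rw [show ζ / r + Uf ζ = ζ * (1 / r + Uf ζ / ζ) by field_simp, mul_pow]
    exact mul_lt_mul_of_pos_left (pow_lt_pow_left₀ hlow (by positivity) two_ne_zero) (by positivity)
  have hR : 5 / 3 * Qf ζ < ζ ^ 2 * (1 / (2 * r)) ^ 2 := by
    have hq' : 5 / 3 * (Qf ζ / ζ ^ 2) < (1 / (2 * r)) ^ 2 := by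
      rw [show (1 / (2 * r)) ^ 2 = 5 / 3 * (3 / (20 * r ^ 2)) by field_simp; ring]
      exact mul_lt_mul_of_pos_left hq.2 (by norm_num)
    rw [show Qf ζ = ζ ^ 2 * (Qf ζ / ζ ^ 2) by field_simp]
    nlinarith [hq', pow_pos hζ0 2]
  linarith

/-- For `b T > -15/16`, `0 ≤ t < T/(1 + bT)`: the projective factor `1 - bt` lies in `(0, 16)` and
the rescaled time `t/(1 - bt)` is `< T`. [folklore] -/
theorem kidder_window {T b t : ℝ} (hT : 0 < T) (hb : -(15 / 16) / T < b) (ht0 : 0 ≤ t)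
    (ht : t < T / (1 + b * T)) : 0 < 1 - b * t ∧ 1 - b * t < 16 ∧ (1 - b * t)⁻¹ * t < T := by
  have hbT : -(15 / 16) < b * T := by rwa [div_lt_iff₀ hT] at hb
  have h1 : 0 < 1 + b * T := by linarith
  have ht' : t * (1 + b * T) < T := by rwa [lt_div_iff₀ h1] at ht
  have key : t < T * (1 - b * t) := by nlinarith [ht']
  have hpos : 0 < 1 - b * t := by
    by_contra h
    linarith [mul_nonpos_of_nonneg_of_nonpos hT.le (not_lt.1 h)]
  refine ⟨hpos, ?_, by rw [inv_mul_lt_iff₀ hpos]; linarith [key]⟩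
  nlinarith [mul_nonneg ht0 (le_of_lt (show 0 < b * T + 15 / 16 by linarith)), key]

/-- The fixed bump of the construction: `= 1` on `‖y‖ ≤ 1/8`, supported in `‖y‖ < 1/4`. -/
def bump : ContDiffBump (0 : V3) := ⟨1 / 8, 1 / 4, by norm_num, by norm_num⟩

variable {F : Type*} [NormedAddCommGroup F] [NormedSpace ℝ F] in
/-- The transplant of `χ • v` read on the plateau: `= v y` for `‖y‖ ≤ 1/8`. [folklore] -/
theorem transplant_bump_smul (v : V3 → F) {y : V3} (hy : ‖y‖ ≤ 1 / 8) :
    Torus.transplant (fun y => (bump : V3 → ℝ) y • v y) (Torus.proj y) = v y := by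
  rw [Torus.transplant_proj_of_norm_lt _ (by linarith), bump.one_of_mem_closedBall (by simpa [bump] using hy),
    one_smul]

variable {F : Type*} [NormedAddCommGroup F] [NormedSpace ℝ F] in
/-- The transplant of `χ • v`, `v` smooth, is smooth on `𝕋³`. [folklore] -/
theorem isSmooth_transplant_bump_smul {v : V3 → F} (hv : ContDiff ℝ ∞ v) :
    Torus.IsSmooth (Torus.transplant (fun y => (bump : V3 → ℝ) y • v y)) :=
  Torus.isSmooth_transplant (bump.contDiff.smul hv)
    ((Function.support_smul_subset_left _ _).trans bump.support_eq.subset)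

section Construction

variable (T r : ℝ)

/-- Self-similar scalar chart field `(T−t)^p S(|y|/(T−t)^{1/r})` of member `0` (density:
`p = −3(1−1/r)`, `S = Pf`; temperature: `p = 2(1/r−1)`, `S = Qf`). -/
def ssScalar (p : ℝ) (S : ℝ → ℝ) (t : ℝ) (y : V3) : ℝ := (T - t) ^ p * S (‖y‖ / (T - t) ^ (1 / r))

/-- Self-similar velocity chart field `(T−t)^{1/r−1} U(|y|/(T−t)^{1/r}) y/|y|` of member `0`. -/
def ssVel (U : ℝ → ℝ) (t : ℝ) (y : V3) : V3 :=
  ((T - t) ^ (1 / r - 1) * U (‖y‖ / (T - t) ^ (1 / r)) / ‖y‖) • y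

/-- Kidder image `λⁿ F(λt, λy)`, `λ = (1 − bt)⁻¹`, of a scalar chart field (`n = 3`: density, `n = 2`:
temperature). -/
def kScalar (n : ℕ) (F : ℝ → V3 → ℝ) (b t : ℝ) (y : V3) : ℝ :=
  (1 - b * t)⁻¹ ^ n * F ((1 - b * t)⁻¹ * t) ((1 - b * t)⁻¹ • y)

/-- Kidder image `λ (u(λt, λy) − b y)` of a velocity chart field. -/
def kVel (u : ℝ → V3 → V3) (b t : ℝ) (y : V3) : V3 :=
  (1 - b * t)⁻¹ • (u ((1 - b * t)⁻¹ * t) ((1 - b * t)⁻¹ • y) - b • y)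

/-- Scalar datum: the transplant of `1 + χ (g − 1)` (activity: `g = Pf₀(|y|/T^{1/r})`; temperature:
`g` = the `t = 0` temperature chart field). -/
def datum (g : V3 → ℝ) (x : T3) : ℝ := 1 + Torus.transplant (fun y => (bump : V3 → ℝ) y • (g y - 1)) x

/-- Velocity datum of member `b`: the transplant of `χ (u − b y)`, `u` the `t = 0` velocity chart field. -/
def velDatum (u : V3 → V3) (b : ℝ) (x : T3) : V3 :=
  Torus.transplant (fun y => (bump : V3 → ℝ) y • (u y - b • y)) x

/-- Reference scalar field of member `b`: the datum `D` at `t = 0`, the transplanted cut-off Kidder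
image of the chart field `F` otherwise. -/
def refScalar (D : T3 → ℝ) (n : ℕ) (F : ℝ → V3 → ℝ) (b t : ℝ) (x : T3) : ℝ :=
  if t = 0 then D x else Torus.transplant (fun y => (bump : V3 → ℝ) y • kScalar n F b t y) x

/-- Reference velocity of member `b`: the datum at `t = 0`, the transplanted cut-off Kidder image of
the chart field `u` otherwise. -/
def refVel (u : ℝ → V3 → V3) (b t : ℝ) (x : T3) : V3 :=
  if t = 0 then velDatum (u 0) b x else Torus.transplant (fun y => (bump : V3 → ℝ) y • kVel u b t y) x

variable {T r}

/-- At `b = 0` the Kidder image is the field itself (scalars). [folklore] -/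
theorem kScalar_zero (n : ℕ) (F : ℝ → V3 → ℝ) (t : ℝ) (y : V3) : kScalar n F 0 t y = F t y := by simp [kScalar]

/-- At `b = 0` the Kidder image is the field itself (velocity). [folklore] -/
theorem kVel_zero (u : ℝ → V3 → V3) (t : ℝ) (y : V3) : kVel u 0 t y = u t y := by simp [kVel]

/-- The `t = 0` scalar chart field is smooth on `ℝ³` when `y ↦ S(|y|)` is. [folklore] -/
theorem contDiff_ssScalar {S : ℝ → ℝ} (hS : ContDiff ℝ ∞ (fun y : V3 => S ‖y‖)) (hT : 0 < T) (p : ℝ) :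
    ContDiff ℝ ∞ (ssScalar T r p S 0) := by
  have e : ssScalar T r p S 0 = fun y => (T - 0) ^ p * (fun y' : V3 => S ‖y'‖) (((T - 0) ^ (-(1 / r))) • y) :=
    funext fun y => by simp only [ssScalar, norm_rpow_neg_smul hT]
  exact e ▸ contDiff_const.mul (hS.comp (contDiff_const_smul _))

/-- The `t = 0` velocity chart field is smooth on `ℝ³` when `y ↦ U(|y|) y/|y|` is. [folklore] -/
theorem contDiff_ssVel {U : ℝ → ℝ} (hU : ContDiff ℝ ∞ (fun y : V3 => (U ‖y‖ / ‖y‖) • y)) (hT : 0 < T) :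
    ContDiff ℝ ∞ (ssVel T r U 0) := by
  have e : ssVel T r U 0 =
      fun y => (T - 0) ^ (1 / r - 1) • (fun y' : V3 => (U ‖y'‖ / ‖y'‖) • y') (((T - 0) ^ (-(1 / r))) • y) :=
    funext fun y => selfSimilar_velocity_eq U hT r y
  exact e ▸ (hU.comp (contDiff_const_smul _)).const_smul _

/-- A scalar datum is smooth. [folklore] -/
theorem isSmooth_datum {g : V3 → ℝ} (hg : ContDiff ℝ ∞ g) : Torus.IsSmooth (datum g) :=
  (Torus.isSmooth_const (1 : ℝ)).add (isSmooth_transplant_bump_smul (hg.sub contDiff_const))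

/-- A scalar datum is positive when `g` is (`1 + χ(g − 1) = (1 − χ) + χ g`). [folklore] -/
theorem datum_pos {g : V3 → ℝ} (hg : ∀ y, 0 < g y) (x : T3) : 0 < datum g x := by
  rw [datum, Torus.transplant_apply, smul_eq_mul]
  have h0 := bump.nonneg (x := Torus.reprc x)
  have h1 := bump.le_one (x := Torus.reprc x)
  have h2 := hg (Torus.reprc x)
  nlinarith [mul_nonneg h0 h2.le, mul_nonneg (sub_nonneg.2 h1) h2.le]

/-- On the plateau a scalar datum is `g`. [folklore] -/
theorem datum_proj (g : V3 → ℝ) {y : V3} (hy : ‖y‖ ≤ 1 / 8) : datum g (Torus.proj y) = g y := by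
  rw [datum, transplant_bump_smul _ hy, add_sub_cancel]

/-- The velocity data are smooth. [folklore] -/
theorem isSmooth_velDatum {u : V3 → V3} (hu : ContDiff ℝ ∞ u) (b : ℝ) : Torus.IsSmooth (velDatum u b) :=
  isSmooth_transplant_bump_smul (hu.sub (contDiff_const_smul b))

/-- On the plateau the velocity datum of member `b` is `u − b y`. [folklore] -/
theorem velDatum_proj (u : V3 → V3) (b : ℝ) {y : V3} (hy : ‖y‖ ≤ 1 / 8) :
    velDatum u b (Torus.proj y) = u y - b • y := by
  rw [velDatum, transplant_bump_smul _ hy]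

end Construction

/-! ## The stub -/

/-- **Stub `stub_kidderKnob`** (kinematic knob family): from the Buckmaster–Cao-Labora–Gómez-Serrano
profile theorem at `γ = 5/3` a `KnobFamily` exists — profiles from `exists_knobProfile` with the
density profile rescaled by `T^{3(1−1/r)}/∫a₀`, `Rc = 1/128`, `T = (Rc/(2Z))^r` with `Z` a bound of
the subsonic set, `x₀ = 0`, `bLo = −(15/16)/T`, data and reference fields transplanted cut-off
chart formulas (module docstring). [cite: BuckmasterCaolaboraGomezserrano2025, Thm 1.1] -/
theorem stub_kidderKnob : KidderKnob := by
  intro hBCG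
  obtain ⟨r, P0, U, Q, hr, hP3, hU3, hQ3, hpos, hisen, hode, hUinf, hQinf⟩ := exists_knobProfile hBCG
  have hr0 : 0 < r := by linarith [hr.1]
  obtain ⟨Z, hZ, hcone⟩ := exists_subsonic_bound hr0 hUinf hQinf
  -- scales: core radius `Rc = 1/128`, blow-up time `T = (Rc/(2Z))^r`
  obtain ⟨Rc, hRc⟩ : ∃ Rc : ℝ, Rc = 1 / 128 := ⟨_, rfl⟩
  have hRc0 : 0 < Rc := by rw [hRc]; norm_num
  obtain ⟨T, hTdef⟩ : ∃ T : ℝ, T = (Rc / (2 * Z)) ^ r := ⟨_, rfl⟩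
  have hT : 0 < T := by rw [hTdef]; exact Real.rpow_pos_of_pos (by positivity) r
  have hT1r : T ^ (1 / r) = Rc / (2 * Z) := by
    rw [hTdef, one_div, Real.rpow_rpow_inv (by positivity) hr0.ne']
  -- `t = 0` chart fields, the activity `a₀ = datum (ssScalar T r 0 P0 0)`, the rescaling `μ = T^{3(1-1/r)}/∫a₀`
  have hac := contDiff_ssScalar (r := r) hP3 hT 0
  have hθc := contDiff_ssScalar (r := r) hQ3 hT (2 * (1 / r - 1))
  have huc := contDiff_ssVel (r := r) hU3 hT
  have hss_pos : ∀ (p : ℝ) (S : ℝ → ℝ), (∀ ζ, 0 ≤ ζ → 0 < S ζ) → ∀ y, 0 < ssScalar T r p S 0 y :=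
    fun p S hS y => mul_pos (Real.rpow_pos_of_pos (by rwa [sub_zero]) _) (hS _ (by positivity))
  have ha_pos := datum_pos (hss_pos 0 P0 fun ζ hζ => (hpos ζ hζ).1)
  obtain ⟨I, hI⟩ : ∃ I : ℝ, I = ∫ x, datum (ssScalar T r 0 P0 0) x := ⟨_, rfl⟩
  have hI0 : 0 < I := hI ▸ (isSmooth_datum hac).continuous.integral_pos_of_hasCompactSupport_nonneg_nonzero
    (HasCompactSupport.of_compactSpace _) (fun x => (ha_pos x).le) (ha_pos 0).ne'
  obtain ⟨μ, hμ⟩ : ∃ μ : ℝ, μ = T ^ (3 * (1 - 1 / r)) / I := ⟨_, rfl⟩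
  have hμ0 : 0 < μ := by rw [hμ]; exact div_pos (Real.rpow_pos_of_pos hT _) hI0
  have hy8_of : ∀ {y : V3}, ‖y‖ < Rc → ‖y‖ ≤ 1 / 8 := fun hy => by rw [hRc] at hy; linarith
  refine ⟨{ x₀ := 0, Rc := Rc, T := T, r := r, bLo := -(15 / 16) / T,
            a₀ := datum (ssScalar T r 0 P0 0), θ₀ := datum (ssScalar T r (2 * (1 / r - 1)) Q 0),
            u₀ := velDatum (ssVel T r U 0), Pf := fun ζ => μ * P0 ζ, Uf := U, Qf := Q,
            ρI := refScalar (fun x => datum (ssScalar T r 0 P0 0) x / ∫ x', datum (ssScalar T r 0 P0 0) x')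
              3 (ssScalar T r (-(3 * (1 - 1 / r))) fun ζ => μ * P0 ζ),
            θI := refScalar (datum (ssScalar T r (2 * (1 / r - 1)) Q 0)) 2 (ssScalar T r (2 * (1 / r - 1)) Q),
            uI := refVel (ssVel T r U),
            hRc := ⟨hRc0, by rw [hRc]; norm_num⟩, hT := hT, hr := hr,
            hbLo := by rw [div_mul_cancel₀ _ hT.ne']; norm_num,
            cont := ⟨(isSmooth_datum hac).continuous, (isSmooth_datum hθc).continuous,
              fun b => (isSmooth_velDatum huc b).continuous⟩,
            pos := fun x => ⟨ha_pos x, datum_pos (hss_pos _ Q fun ζ hζ => (hpos ζ hζ).2) x⟩,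
            smoothActivity := (show ContDiff ℝ ∞ (Torus.lift (datum _)) from isSmooth_datum hac).div_const _,
            knobData := fun b y hy => by
              rw [zero_add, velDatum_proj _ _ (hy8_of hy), velDatum_proj _ _ (hy8_of hy), zero_smul, sub_zero],
            data := fun b _ => ⟨fun x => by simp [refScalar], by funext x; simp [refVel],
              by funext x; simp [refScalar]⟩,
            smoothProfile := ⟨contDiff_const.mul hP3, hU3, hQ3⟩,
            profilePos := fun ζ hζ => ⟨mul_pos hμ0 (hpos ζ hζ).1, (hpos ζ hζ).2⟩,
            isentropic := ?_, profileODE := ?_, farField := ⟨hUinf, hQinf⟩, coneInCore := ?_,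
            selfSimilar := ?_, kidder := ?_ }⟩
  · obtain ⟨k, hk, hkQ⟩ := hisen
    have hμ23 : 0 < μ ^ (2 / 3 : ℝ) := Real.rpow_pos_of_pos hμ0 _
    refine ⟨k / μ ^ (2 / 3 : ℝ), by positivity, fun ζ hζ => ?_⟩
    rw [Real.mul_rpow hμ0.le (hpos ζ hζ).1.le, hkQ ζ hζ]
    field_simp
  · intro ζ hζ
    obtain ⟨h1, h2, h3⟩ := hode ζ hζ
    have hd : deriv (fun ζ => μ * P0 ζ) ζ = μ * deriv P0 ζ := deriv_const_mul_field μ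
    refine ⟨?_, ?_, h3⟩
    · rw [hd]
      linear_combination μ * h1
    · rw [hd, mul_left_comm (Q ζ) μ, mul_div_mul_left _ _ hμ0.ne']
      exact h2
  · intro ζ hζ hc
    rw [hT1r]
    calc ζ * (Rc / (2 * Z)) < Z * (Rc / (2 * Z)) := mul_lt_mul_of_pos_right (hcone ζ hζ hc) (by positivity)
      _ = Rc / 2 := by field_simp
      _ < Rc := by linarith
  · intro t ht0 htT y hy
    have hy8 := hy8_of hy
    rw [zero_add]
    by_cases ht : t = 0
    · subst ht
      refine ⟨?_, by simp [refVel, velDatum_proj _ _ hy8, ssVel], by simp [refScalar, datum_proj _ hy8, ssScalar]⟩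
      simp only [refScalar, if_true]
      rw [← hI, datum_proj _ hy8, hμ, ssScalar]
      simp only [sub_zero, Real.rpow_zero, one_mul]
      rw [Real.rpow_neg hT.le]
      have hTβ : T ^ (3 * (1 - 1 / r)) ≠ 0 := (Real.rpow_pos_of_pos hT _).ne'
      field_simp
    · simp only [refScalar, refVel, ht, if_false]
      rw [transplant_bump_smul _ hy8, transplant_bump_smul _ hy8, transplant_bump_smul _ hy8, kScalar_zero,
        kVel_zero, kScalar_zero]
      exact ⟨rfl, rfl, rfl⟩
  · intro b hb t ht0 htT y hy
    obtain ⟨hlpos, hl16, -⟩ := kidder_window hT hb ht0 htT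
    have hy8 : ‖y‖ ≤ 1 / 8 := by
      have : Rc * (1 - b * t) ≤ 1 / 8 := by rw [hRc]; nlinarith
      linarith
    have hL0 : 0 < (1 - b * t)⁻¹ := inv_pos.2 hlpos
    have hLy : ‖(1 - b * t)⁻¹ • y‖ < Rc := by
      rw [norm_smul, Real.norm_of_nonneg hL0.le]
      calc (1 - b * t)⁻¹ * ‖y‖ < (1 - b * t)⁻¹ * (Rc * (1 - b * t)) := mul_lt_mul_of_pos_left hy hL0
        _ = Rc := by field_simp
    have hLy8 := hy8_of hLy
    rw [zero_add, zero_add]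
    by_cases ht : t = 0
    · subst ht
      simp [refScalar, refVel, velDatum_proj _ _ hy8]
    · have hLt : (1 - b * t)⁻¹ * t ≠ 0 := mul_ne_zero hL0.ne' ht
      simp only [refScalar, refVel, ht, hLt, if_false]
      rw [transplant_bump_smul _ hy8, transplant_bump_smul _ hLy8, transplant_bump_smul _ hy8,
        transplant_bump_smul _ hLy8, transplant_bump_smul _ hy8, transplant_bump_smul _ hLy8, kScalar_zero,
        kVel_zero, kScalar_zero]
      exact ⟨rfl, rfl, rfl⟩

end Summit.AtomisticToContinuum.HydrodynamicLimit.Theorems.KidderKnobMelnikov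

end
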